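import Summits.ABC.IUTFork.LambdaLineQuadraticWitness
import HarnessLib

/-!
# Branch C at `d_mod ≥ 2`: an ADMISSIBLE DEGREE-2 Θ-datum locus on the `λ`-line — non-vacuity of every `d_mod ≥ 2` binder
# (`hvol`/`hreg` off the «d = 1 cut», `hSz`, the necessity certificates) and REFUTATION of the pure Szpiro-type trade binder

Proof-only file (0 definitions, no new `Prop`) of the abc-iut cell (R2 S-chain seat abc-iut-s2-p5, TARGET #1 «hvol residue»), over
the arithmetic of `Summits/ABC/IUTFork/LambdaLineQuadraticWitness.lean` (p441759: `F = ℚ(√2)`, `λ_k = 1/2 + 2/(3+√2)^k`, the two places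
`𝔭 ∋ 3+√2`, `𝔭' ∋ 3−√2` over the MIXED prime `7`, `ord_𝔭 j(λ_k) = −2k·ord_𝔭(3+√2)`, `ord_{𝔭'} j(λ_k) = 0`). CLASSICAL; nothing disputed
is used or asserted; no side taken on [IUTchIII] Cor. 3.12. Degree-2 twin of abc-iut-S-d3's `Corollary22Thm110LegendreWitness`
(`exists_thm110Legendre_antecedent`, rational family, `d_mod = 1`):

* `P k = (F, λ_k)`; `finrank_F` (`[F:ℚ] = 2`); `ord_ratCast_neg_of_neg` — a RATIONAL number has `ord` of the same sign at the two
  places over `7` (it reads `ord_7` of the denominator), the lever for `j(λ_k) ∉ ℚ` and `λ_k ∉ ℚ`;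
* `P_mem_std` — `P_k ∈ K_V = CBData.std {2}` for `k ≥ 6` (`‖τ√2‖ = √2 ≤ 3/2` in `ℂ`; `‖τ√2‖ < 1 = ‖3‖` in `Q̄₂`, ultrametric);
* `admitsCore_P`, `two_le_dmod_P` (`2 ≤ d_mod`), `P_mem_UP` (`λ_k ≠ 0,1`, `ℚ(λ_k) = F`), `condP5_P` (every prime `l ≠ 7`),
  `le_logQAvoid_P` (`k·log 2 ≤ log(q^{∤{2,l}}(λ_k))`, every prime `l ≠ 7`);
* **`exists_admissible_two_le_dmod`** — ∀ `H` ∃ `P ∈ UP ∩ K_V`, `2 ≤ d_mod P`, prime `l ≥ 7`, `AdmitsCore`, (P2) (`condP2_of_lt`), (P5),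
  (P6) (the tree's PROVED (P4) ⟹ (P6) `Cor22.condP6_of_seven_le`), `H < log(q^∀(P))`: the admissible antecedent at `d_mod ≥ 2` is
  SATISFIABLE at unbounded height, so the `d_mod ≥ 2` residue of TARGET #1 is not a statement about the empty set
  (with `ThetaPartII.stub_thetaData` these points carry genuine Θ-volume data);
* **`not_szpiroPure`** — the PURE Szpiro-type binder `∀ admissible (P,l), 2 ≤ d_mod → logQAvoid P {2,l} ≤ 24(d_mod−1)/l·(log-diff +
  logCondAvoid P {2,l})` (the hypothesis shape of abc-iut-s2-p1's `hullVolumeAtDatum_BIII_of_logQAvoid_le_szpiro'`, composed into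
  `abc_of_S_v3` by abc-iut-s2-ref's `ProbeSzpiroSlack`) is FALSE: at `P_k` the left side is `≥ k·log 2` for every prime `l ≠ 7` while
  the right side is `≤ 24(d_mod−1)(log-diff + log-cond)/l → 0` along the admissible primes. The π-slack form (the binder of s2-p1's
  `hvol_of_szpiroSuff`, with `+ 40·log(d*l)·max(0, π(d*l) − …)`) is NOT refuted by this argument.

READING (neutral): a TRADE of `hvol` for a Diophantine binder must use the π-slack form (the pure form makes the certificate vacuous).
Nothing here bears on [IUTchIII] Cor. 3.12 / [IUTchIV] Thm. 1.10; typed ≠ proved. [cite: Mochizuki2012, IUTchIV Cor 2.2 (ii) proof (P1)-(P7) pp.45-46]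
[cite: MochizukiGenEll2010, Ex 1.3 (ii) p.5]
-/

noncomputable section

namespace Summit.ABC.IUTFork.QuadWitness

open NumberField IsDedekindDomain Polynomial Literature.NumberTheory.DiophantineGeometry.GenEll
open Literature.IUT.LogVolume Literature.IUT.LogVolume.Cor22

/-- The `λ`-line point `P_k = (ℚ(√2), λ_k)`. -/
abbrev P (k : ℕ) : NFPoint := ⟨F, lam k⟩

/-- `[F : ℚ] = 2`. -/
theorem finrank_F : Module.finrank ℚ F = 2 := by
  rw [(AdjoinRoot.powerBasis fpoly_ne_zero).finrank, AdjoinRoot.powerBasis_dim]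
  show (X ^ 2 - C (2 : ℚ)).natDegree = 2
  rw [natDegree_X_pow_sub_C]

/-! ### Rational numbers at the two places over `7`: the sign of `ord` is the same -/

/-- For a rational `q` and two places `v, w` over `7`: `ord_v q < 0 → ord_w q < 0` (both read `ord_7` of the denominator). -/
theorem ord_ratCast_neg_of_neg {v w : HeightOneSpectrum (𝓞 F)} (h7v : ((7 : ℕ) : 𝓞 F) ∈ v.asIdeal)
    (h7w : ((7 : ℕ) : 𝓞 F) ∈ w.asIdeal) (q : ℚ) (hq : ord F v (q : F) < 0) : ord F w (q : F) < 0 := by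
  have hq0 : q ≠ 0 := by rintro rfl; simp [ord_zero] at hq
  have hnum0 : q.num ≠ 0 := Rat.num_ne_zero.mpr hq0
  have hcast : ((q : ℚ) : F) = ((q.num : 𝓞 F) : F) / (((q.den : ℕ) : 𝓞 F) : F) := by
    show (q : F) = algebraMap (𝓞 F) F (q.num : 𝓞 F) / algebraMap (𝓞 F) F ((q.den : ℕ) : 𝓞 F)
    rw [map_intCast, map_natCast, Rat.cast_def]
  have hnumF : ((q.num : 𝓞 F) : F) ≠ 0 := by exact_mod_cast hnum0
  have hdenF : (((q.den : ℕ) : 𝓞 F) : F) ≠ 0 := by exact_mod_cast q.den_ne_zero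
  have key : ∀ u : HeightOneSpectrum (𝓞 F), ord F u (q : F) = ord F u ((q.num : 𝓞 F) : F) - ord F u (((q.den : ℕ) : 𝓞 F) : F) :=
    fun u => by rw [hcast, ord_div' u hnumF hdenF]
  have hden_v : ((q.den : ℕ) : 𝓞 F) ∈ v.asIdeal := by
    by_contra hnot
    have h1 := ord_nonneg_of_isIntegral F v (q.num : 𝓞 F)
    have h2 := ord_coe_eq_zero_of_not_mem hnot
    rw [key v, h2] at hq
    omega
  have h7den : 7 ∣ q.den := by
    by_contra hnd
    exact natCast_not_mem_of_coprime h7v ((Nat.coprime_comm.mp ((Nat.Prime.coprime_iff_not_dvd (by norm_num)).mpr hnd))) hden_v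
  have hden_w : ((q.den : ℕ) : 𝓞 F) ∈ w.asIdeal := by
    obtain ⟨c, hc⟩ := h7den
    rw [hc]; push_cast; exact w.asIdeal.mul_mem_right _ h7w
  have hnum_w : (q.num : 𝓞 F) ∉ w.asIdeal := by
    have hcop : Nat.Coprime q.num.natAbs 7 := Nat.Coprime.coprime_dvd_right h7den q.reduced
    have h1 : ((q.num.natAbs : ℕ) : 𝓞 F) ∉ w.asIdeal := natCast_not_mem_of_coprime h7w hcop
    intro hmem
    apply h1
    rcases Int.natAbs_eq q.num with h | h
    · have e : (q.num : 𝓞 F) = ((q.num.natAbs : ℕ) : 𝓞 F) := by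
        have := congrArg (fun z : ℤ => (z : 𝓞 F)) h
        simpa only [Int.cast_natCast] using this
      rwa [e] at hmem
    · have e : (q.num : 𝓞 F) = -((q.num.natAbs : ℕ) : 𝓞 F) := by
        have := congrArg (fun z : ℤ => (z : 𝓞 F)) h
        simpa only [Int.cast_neg, Int.cast_natCast] using this
      rw [e] at hmem; exact (Ideal.neg_mem_iff _).mp hmem
  have hpos : 0 < ord F w (((q.den : ℕ) : 𝓞 F) : F) :=
    (ord_pos_iff_mem F w _ (by exact_mod_cast q.den_ne_zero)).mpr hden_w
  rw [key w, ord_coe_eq_zero_of_not_mem hnum_w]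
  omega

/-! ### `λ_k ∈ K_V = CBData.std {2}` (`k ≥ 6`) -/

/-- Under any ring map `τ : F → ℂ`: `‖τ √2‖ = √2 ≤ 3/2`, so `‖τ(3 + √2)‖ ≥ 3/2`. -/
theorem norm_emb_a_ge (τ : F →+* ℂ) : (3 : ℝ) / 2 ≤ ‖τ (a : F)‖ := by
  have hs2 : ‖τ s‖ ^ 2 = 2 := by
    rw [← norm_pow, ← map_pow, s_sq, map_ofNat τ 2]; simp
  have hs : ‖τ s‖ ≤ 3 / 2 := by nlinarith [norm_nonneg (τ s)]
  have e : τ (a : F) = 3 + τ s := by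
    show τ (3 + s) = _
    rw [map_add, map_ofNat τ 3]
  rw [e]
  have h := norm_sub_norm_le (3 : ℂ) (-(τ s))
  rw [sub_neg_eq_add, norm_neg] at h
  have h3 : ‖(3 : ℂ)‖ = 3 := by simp
  linarith

/-- Under any ring map `τ : F → Q̄₂`: `‖τ √2‖ < 1 = ‖3‖`, so `‖τ(3 + √2)‖ = 1`. -/
theorem norm_emb_a_two (τ : F →+* PadicAlgCl 2) : ‖τ (a : F)‖ = 1 := by
  have h2 : ‖(2 : PadicAlgCl 2)‖ < 1 := by
    have e : (2 : PadicAlgCl 2) = (((2 : ℕ) : ℚ_[2]) : PadicAlgCl 2) := by push_cast; rfl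
    rw [e, PadicAlgCl.norm_extends]
    exact Padic.norm_p_lt_one
  have hs2 : ‖τ s‖ ^ 2 = ‖(2 : PadicAlgCl 2)‖ := by
    rw [← norm_pow, ← map_pow, s_sq, map_ofNat τ 2]
  have hs : ‖τ s‖ < 1 := by nlinarith [norm_nonneg (τ s), norm_nonneg (2 : PadicAlgCl 2)]
  have h3 : ‖(3 : PadicAlgCl 2)‖ = 1 := by
    have e : (3 : PadicAlgCl 2) = (((3 : ℕ) : ℚ_[2]) : PadicAlgCl 2) := by push_cast; rfl
    rw [e, PadicAlgCl.norm_extends, Padic.norm_natCast_eq_one_iff]; norm_num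
  have e : τ (a : F) = 3 + τ s := by
    show τ (3 + s) = _
    rw [map_add, map_ofNat τ 3]
  rw [e, IsUltrametricDist.norm_add_eq_max_of_norm_ne_norm (by rw [h3]; exact hs.ne'), h3]
  exact max_eq_left hs.le

/-- The image of `λ_k` under a ring map: `τ(λ_k) − 1/2 = 2/τ(a)^k`. -/
theorem emb_lam_sub_half {L : Type*} [Field L] (τ : F →+* L) (k : ℕ) :
    τ (lam k) - 2⁻¹ = 2 / τ (a : F) ^ k := by
  simp only [lam, map_add, map_inv₀, map_div₀, map_pow, map_ofNat]
  ring

/-- `hS2` (degree-2 admissibility witness `λ_k = 1/2 + 2/(3+√2)^k`). [cite: MochizukiGenEll2010, Ex 1.3 (ii) p.5] -/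
theorem hS2 : ∀ p ∈ ({2} : Finset ℕ), p.Prime := by simp [Nat.prime_two]

/-- **`P_k ∈ K_V = CBData.std {2}`** for `k ≥ 6`: `|τ(λ_k) − 1/2| = 2/‖τ(a)‖^k ≤ 2/(3/2)^6 < 1/4`, `‖τ(λ_k) − 1/2‖₂ = ‖2‖₂`.
[cite: MochizukiGenEll2010, Ex 1.3 (ii) p.5] -/
theorem P_mem_std {k : ℕ} (hk : 6 ≤ k) : P k ∈ (CBData.std {2} hS2).toSet := by
  refine ⟨fun τ => ?_, fun p hp _ τ => ?_⟩
  · change τ (lam k) ∈ CBData.stdArc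
    rw [CBData.stdArc, Metric.mem_closedBall, dist_eq_norm, emb_lam_sub_half τ k, norm_div, norm_pow]
    have ha := norm_emb_a_ge τ
    have hpos : (0 : ℝ) < ‖τ (a : F)‖ ^ k := by positivity
    have h6 : ((3 : ℝ) / 2) ^ 6 ≤ ‖τ (a : F)‖ ^ k :=
      le_trans (pow_le_pow_right₀ (by norm_num) hk) (pow_le_pow_left₀ (by norm_num) ha k)
    rw [show ‖(2 : ℂ)‖ = 2 by simp, div_le_iff₀ hpos]
    nlinarith
  · have hp2 : p = 2 := by change p ∈ ({2} : Finset ℕ) at hp; simpa using hp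
    subst hp2
    change τ (lam k) ∈ CBData.stdNon 2
    rw [CBData.stdNon, Metric.mem_closedBall, dist_eq_norm, emb_lam_sub_half τ k, norm_div, norm_pow,
      norm_emb_a_two, one_pow, div_one]
    norm_cast

/-! ### `AdmitsCore`, `2 ≤ d_mod`, `UP`, (P5), `log(q)` at `P_k` -/

section AtPlaces

variable {𝔭 𝔭' : HeightOneSpectrum (𝓞 F)} (ha : a ∈ 𝔭.asIdeal) (habar : abar ∈ 𝔭'.asIdeal) (ha' : a ∉ 𝔭'.asIdeal)
  (h7 : ((7 : ℕ) : 𝓞 F) ∈ 𝔭.asIdeal) (h7' : ((7 : ℕ) : 𝓞 F) ∈ 𝔭'.asIdeal)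
include ha h7

/-- `ord_𝔭 j(λ_k) ≤ −2k ≤ −2` (`k ≥ 1`). -/
theorem ord_jInv_lam_le {k : ℕ} (hk : 1 ≤ k) : ord F 𝔭 (jInv (lam k)) ≤ -(2 * k) := by
  obtain ⟨-, h2, h3⟩ := ord_at_bad h7 ha hk
  rw [h2]
  nlinarith

/-- **`AdmitsCore P_k`**: the four exceptional `j` are `7`-integral, `j(λ_k)` has a pole at `𝔭`. -/
theorem admitsCore_P {k : ℕ} (hk : 1 ≤ k) : AdmitsCore (P k) := by
  have hord := ord_jInv_lam_le ha h7 hk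
  have hnn : ∀ (n m : ℕ), Nat.Coprime m 7 → 0 ≤ ord F 𝔭 ((n : F) / (m : F)) := by
    intro n m hm
    by_cases hn : n = 0
    · subst hn; simp [ord_zero]
    have hn' : (n : F) ≠ 0 := by exact_mod_cast hn
    have hm0 : m ≠ 0 := by rintro rfl; norm_num at hm
    have hm' : (m : F) ≠ 0 := by exact_mod_cast hm0
    rw [ord_div' 𝔭 hn' hm', ord_natCast_eq_zero h7 hm]
    have := ord_nonneg_of_isIntegral F 𝔭 (n : 𝓞 F)
    simpa using this
  have hcontra : ∀ (n m : ℕ), Nat.Coprime m 7 → jInv (lam k) ≠ (n : F) / (m : F) := fun n m hm h => by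
    have := hnn n m hm; rw [← h] at this; omega
  change ∀ q ∈ coreExceptionalJ, jInv (lam k) ≠ ((q : ℚ) : F)
  intro r hr heq
  simp only [coreExceptionalJ, Finset.mem_insert, Finset.mem_singleton] at hr
  rcases hr with rfl | rfl | rfl | rfl
  · exact hcontra 488095744 125 (by norm_num) (by rw [heq]; push_cast; rfl)
  · exact hcontra 1556068 81 (by norm_num) (by rw [heq]; push_cast; rfl)
  · exact hcontra 1728 1 (by norm_num) (by rw [heq]; push_cast; simp)
  · exact hcontra 0 1 (by norm_num) (by rw [heq]; push_cast; simp)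

include habar ha' h7'

/-- **`j(λ_k) ∉ ℚ`, hence `2 ≤ d_mod(P_k)`**: a rational number has `ord` of the same sign at `𝔭` and `𝔭'`,
but `ord_𝔭 j(λ_k) < 0 = ord_{𝔭'} j(λ_k)` — the prime `7` is MIXED. -/
theorem two_le_dmod_P {k : ℕ} (hk : 1 ≤ k) : 2 ≤ dmod (P k) := by
  have hbad := ord_jInv_lam_le ha h7 hk
  have hgood : ord F 𝔭' (jInv (lam k)) = 0 := (ord_at_good h7' habar ha' k).2
  have hne : dmod (P k) ≠ 1 := by
    intro h1
    change Module.finrank ℚ (IntermediateField.adjoin ℚ ({jInv (lam k)} : Set F)) = 1 at h1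
    rw [IntermediateField.finrank_eq_one_iff, IntermediateField.adjoin_simple_eq_bot_iff,
      IntermediateField.mem_bot] at h1
    obtain ⟨q, hq⟩ := h1
    have hq' : jInv (lam k) = ((q : ℚ) : F) := by rw [← hq]; rfl
    rw [hq'] at hbad hgood
    have := ord_ratCast_neg_of_neg h7 h7' q (by omega)
    omega
  have hpos : 0 < dmod (P k) := Module.finrank_pos
  omega

/-- **`P_k ∈ UP`** (`k ≥ 6`): `λ_k ≠ 0, 1` and `ℚ(λ_k) = F` (`λ_k ∉ ℚ` by the same sign argument; `[F:ℚ] = 2`). -/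
theorem P_mem_UP {k : ℕ} (hk : 6 ≤ k) : P k ∈ UP := by
  have hk1 : 1 ≤ k := by omega
  refine ⟨CBData.inU_of_mem (P_mem_std hk), ?_⟩
  have hbad : ord F 𝔭 (lam k) < 0 := by
    obtain ⟨h1, -, h3⟩ := ord_at_bad h7 ha hk1
    rw [h1]; nlinarith
  have hgood : ord F 𝔭' (lam k) = 0 := (ord_at_good h7' habar ha' k).1
  have hnot : (lam k) ∉ (⊥ : IntermediateField ℚ F) := by
    rw [IntermediateField.mem_bot]
    rintro ⟨q, hq⟩
    have hq' : lam k = ((q : ℚ) : F) := by rw [← hq]; rfl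
    rw [hq'] at hbad hgood
    have := ord_ratCast_neg_of_neg h7 h7' q hbad
    omega
  change IntermediateField.adjoin ℚ ({lam k} : Set F) = ⊤
  have hK1 : Module.finrank ℚ (IntermediateField.adjoin ℚ ({lam k} : Set F)) ≠ 1 := by
    rw [Ne, IntermediateField.finrank_eq_one_iff, IntermediateField.adjoin_simple_eq_bot_iff]
    exact hnot
  have htower : Module.finrank ℚ (IntermediateField.adjoin ℚ ({lam k} : Set F)) *
      Module.finrank (IntermediateField.adjoin ℚ ({lam k} : Set F)) F = 2 := by
    rw [Module.finrank_mul_finrank, finrank_F]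
  have hKpos : 0 < Module.finrank ℚ (IntermediateField.adjoin ℚ ({lam k} : Set F)) := Module.finrank_pos
  have hKF : Module.finrank (IntermediateField.adjoin ℚ ({lam k} : Set F)) F = 1 := by
    have hle : Module.finrank ℚ (IntermediateField.adjoin ℚ ({lam k} : Set F)) ≤ 2 :=
      Nat.le_of_dvd (by norm_num) ⟨_, htower.symm⟩
    interval_cases (Module.finrank ℚ (IntermediateField.adjoin ℚ ({lam k} : Set F))) <;> omega
  exact IntermediateField.finrank_eq_one_iff_eq_top.mp hKF

omit habar ha' h7' in
/-- **(P5) at `P_k`** for every prime `l ≠ 7`: the pole `𝔭` of `j(λ_k)` divides neither `2` nor `l`. -/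
theorem condP5_P {k : ℕ} (hk : 1 ≤ k) {l : ℕ} (hl : l.Prime) (hl7 : l ≠ 7) : CondP5 (P k) l := by
  have hord := ord_jInv_lam_le ha h7 hk
  refine ⟨𝔭, by change ord F 𝔭 (jInv (lam k)) < 0; omega, natCast_not_mem_of_coprime h7 (by norm_num), ?_⟩
  exact natCast_not_mem_of_coprime h7 ((Nat.coprime_primes hl (by norm_num)).mpr hl7)

omit habar ha' h7' in
/-- **`k·log 2 ≤ log(q^{∤{2,l}}(λ_k))`** for every prime `l ≠ 7` (the pole at `𝔭` has order `≥ 2k`, `log N(𝔭) ≥ log 2`,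
`[F:ℚ] = 2`); with `l = 3` this bounds `log(q^∀(λ_k)) ≥ log(q^{∤{2,3}})` too. -/
theorem le_logQAvoid_P {k : ℕ} (hk : 1 ≤ k) {l : ℕ} (hl : l.Prime) (hl7 : l ≠ 7) :
    (k : ℝ) * Real.log 2 ≤ logQAvoid (P k) {2, l} := by
  classical
  have hord := ord_jInv_lam_le ha h7 hk
  have hbadP : 𝔭 ∈ badPlaces (P k) := (mem_badPlaces_iff_ord_neg (P k) 𝔭).mpr (by change ord F 𝔭 (jInv (lam k)) < 0; omega)
  have hmem : 𝔭 ∈ (badPlaces (P k)).filter (fun v => ∀ p ∈ ({2, l} : Finset ℕ), ((p : ℕ) : 𝓞 (P k).F) ∉ v.asIdeal) :=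
    Finset.mem_filter.mpr ⟨hbadP, fun p hp => by
      simp only [Finset.mem_insert, Finset.mem_singleton] at hp
      rcases hp with rfl | rfl
      · exact natCast_not_mem_of_coprime h7 (by norm_num)
      · exact natCast_not_mem_of_coprime h7 ((Nat.coprime_primes hl (by norm_num)).mpr hl7)⟩
  have hle : localHeight (P k) 𝔭 * logNorm F 𝔭 ≤ ((P k).degree : ℝ) * logQAvoid (P k) {2, l} := by
    rw [degree_mul_logQAvoid (P k) {2, l}]
    exact Finset.single_le_sum (f := fun w => localHeight (P k) w * logNorm F w)
      (fun w _ => mul_nonneg (localHeight_nonneg (P k) w) (logNorm_pos F w).le) hmem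
  rw [localHeight_eq_neg_ord hbadP] at hle
  have hdeg : ((P k).degree : ℝ) = 2 := by
    change ((Module.finrank ℚ F : ℕ) : ℝ) = 2
    rw [finrank_F]; norm_num
  rw [hdeg] at hle
  have hlogN : Real.log 2 ≤ logNorm F 𝔭 := by
    unfold logNorm
    exact Real.log_le_log (by norm_num) (by exact_mod_cast NumberField.HeightOneSpectrum.one_lt_absNorm 𝔭)
  have hh : (2 : ℝ) * k ≤ -(ord F 𝔭 (jInv (lam k)) : ℝ) := by
    have := (Int.cast_le (R := ℝ)).mpr hord
    push_cast at this; linarith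
  have hlog2 : 0 < Real.log 2 := Real.log_pos (by norm_num)
  change -(ord F 𝔭 (jInv (lam k)) : ℝ) * logNorm F 𝔭 ≤ 2 * logQAvoid (P k) {2, l} at hle
  nlinarith [mul_le_mul hh hlogN hlog2.le (by linarith)]

end AtPlaces

/-! ### The admissible DEGREE-2 witnesses; the pure Szpiro-type trade binder is FALSE -/

/-- **NON-VACUITY AT `d_mod ≥ 2` of the admissible antecedent** (degree-2 twin of abc-iut-S-d3's
`Cor22.exists_thm110Legendre_antecedent`): for every `H` there are a `λ`-line point `P ∈ UP ∩ K_V` (`K_V = CBData.std {2}`) with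
`2 ≤ d_mod(P)` and a prime `l ≥ 7` with `AdmitsCore P`, (P2), (P5), (P6) — the last by the tree's PROVED (P4) ⟹ (P6)
`Cor22.condP6_of_seven_le` — and `H < log(q^∀(P))`; here `P = (ℚ(√2), 1/2 + 2/(3+√2)^k)`. So every `d_mod ≥ 2` binder of the
branch-C scoreboard (`hvol`/`hreg` off the «d = 1 cut», `hSz`, the necessity certificates) quantifies over a NON-EMPTY,
unbounded-height range of genuine Θ-data (`ThetaPartII.stub_thetaData`). [cite: Mochizuki2012, IUTchIV Cor 2.2 (ii) proof (P1)-(P7) pp.45-46]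
[cite: MochizukiGenEll2010, Ex 1.3 (ii) p.5] -/
theorem exists_admissible_two_le_dmod (H : ℝ) :
    ∃ (P₀ : NFPoint) (l : ℕ), P₀ ∈ UP ∧ P₀ ∈ (CBData.std {2} hS2).toSet ∧ 2 ≤ dmod P₀ ∧
      l.Prime ∧ 7 ≤ l ∧ AdmitsCore P₀ ∧ CondP2 P₀ l ∧ CondP5 P₀ l ∧ CondP6 P₀ l ∧ H < logQForall P₀ := by
  obtain ⟨𝔭, 𝔭', ha, habar, ha', -, h7, h7'⟩ := exists_places
  obtain ⟨HK, hHK⟩ := condP6_of_seven_le (CBData.std {2} hS2)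
  have hlog2 : 0 < Real.log 2 := Real.log_pos (by norm_num)
  obtain ⟨k, hk6, hkM⟩ : ∃ k : ℕ, 6 ≤ k ∧ max H HK < k * Real.log 2 := by
    refine ⟨max 6 (⌈max H HK / Real.log 2⌉₊ + 1), le_max_left _ _, ?_⟩
    have h1 : max H HK / Real.log 2 ≤ ⌈max H HK / Real.log 2⌉₊ := Nat.le_ceil _
    have h2 : ((⌈max H HK / Real.log 2⌉₊ + 1 : ℕ) : ℝ) ≤ ((max 6 (⌈max H HK / Real.log 2⌉₊ + 1) : ℕ) : ℝ) := by
      exact_mod_cast le_max_right _ _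
    have h3 : max H HK < ((⌈max H HK / Real.log 2⌉₊ + 1 : ℕ) : ℝ) * Real.log 2 := by
      push_cast; rw [div_le_iff₀ hlog2] at h1; nlinarith
    exact lt_of_lt_of_le h3 (mul_le_mul_of_nonneg_right h2 hlog2.le)
  have hk1 : 1 ≤ k := by omega
  have hlogQ : max H HK < logQForall (P k) :=
    lt_of_lt_of_le hkM ((le_logQAvoid_P ha h7 hk1 Nat.prime_three (by norm_num)).trans
      (logQAvoid_anti (P k) (Finset.empty_subset _)))
  obtain ⟨l, hl, hlp⟩ := Nat.exists_infinite_primes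
    (max 8 (⌈((P k).degree : ℝ) * logQForall (P k) / Real.log 2⌉₊ + 1))
  have hl8 : 8 ≤ l := (le_max_left _ _).trans hl
  have hP2 : CondP2 (P k) l := by
    apply condP2_of_lt
    have h2 := Nat.le_ceil (((P k).degree : ℝ) * logQForall (P k) / Real.log 2)
    have h3 : ((⌈((P k).degree : ℝ) * logQForall (P k) / Real.log 2⌉₊ + 1 : ℕ) : ℝ) ≤ l := by
      exact_mod_cast (le_max_right _ _).trans hl
    push_cast at h3; linarith
  have hUP := P_mem_UP ha habar ha' h7 h7' hk6
  have hP5 := condP5_P ha h7 hk1 hlp (by omega)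
  exact ⟨P k, l, hUP, P_mem_std hk6, two_le_dmod_P ha habar ha' h7 h7' hk1, hlp, by omega, admitsCore_P ha h7 hk1, hP2,
    hP5, hHK (P k) (P_mem_std hk6) hUP l hlp (by omega) hP2 hP5 (lt_of_le_of_lt (le_max_right _ _) hlogQ),
    lt_of_le_of_lt (le_max_left _ _) hlogQ⟩

/-- **The PURE Szpiro-type trade binder is FALSE.** The hypothesis of abc-iut-s2-p1's
`PointDict.hullVolumeAtDatum_BIII_of_logQAvoid_le_szpiro'` quantified over all admissible `(P, l)` with `2 ≤ d_mod` —
`logQAvoid P {2,l} ≤ 24(d_mod − 1)/l·(log-diff + logCondAvoid P {2,l})`, the form composed into `abc_of_S_v3` by abc-iut-s2-ref's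
`ProbeSzpiroSlack` — fails: at the admissible degree-2 point `P_k` the left side is `≥ k·log 2` for EVERY prime `l ≠ 7`
(`le_logQAvoid_P`) while the right side is `≤ 24(d_mod − 1)(log-diff + log-cond)/l → 0` as `l → ∞` through the admissible
primes ((P2) by `condP2_of_lt`, (P6) by `condP6_of_seven_le`). The π-slack form (`hvol_of_szpiroSuff`'s binder) is NOT refuted
by this. Nothing asserted about [IUTchIII] Cor. 3.12 / [IUTchIV] Thm. 1.10. [cite: Mochizuki2012, IUTchIV Cor 2.2 (ii) proof p.46] -/
theorem not_szpiroPure :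
    ¬ (∀ P₀ : NFPoint, P₀ ∈ UP → ∀ l : ℕ, l.Prime → 5 ≤ l →
        AdmitsCore P₀ → CondP2 P₀ l → CondP5 P₀ l → CondP6 P₀ l → 2 ≤ dmod P₀ →
          logQAvoid P₀ {2, l} ≤ 24 * ((dmod P₀ : ℝ) - 1) / l * (P₀.logDiff + logCondAvoid P₀ {2, l})) := by
  intro hSz
  obtain ⟨𝔭, 𝔭', ha, habar, ha', -, h7, h7'⟩ := exists_places
  obtain ⟨HK, hHK⟩ := condP6_of_seven_le (CBData.std {2} hS2)
  have hlog2 : 0 < Real.log 2 := Real.log_pos (by norm_num)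
  obtain ⟨k, hk6, hkM⟩ : ∃ k : ℕ, 6 ≤ k ∧ HK < k * Real.log 2 := by
    refine ⟨max 6 (⌈HK / Real.log 2⌉₊ + 1), le_max_left _ _, ?_⟩
    have h1 : HK / Real.log 2 ≤ ⌈HK / Real.log 2⌉₊ := Nat.le_ceil _
    have h2 : ((⌈HK / Real.log 2⌉₊ + 1 : ℕ) : ℝ) ≤ ((max 6 (⌈HK / Real.log 2⌉₊ + 1) : ℕ) : ℝ) := by
      exact_mod_cast le_max_right _ _
    have h3 : HK < ((⌈HK / Real.log 2⌉₊ + 1 : ℕ) : ℝ) * Real.log 2 := by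
      push_cast; rw [div_le_iff₀ hlog2] at h1; nlinarith
    exact lt_of_lt_of_le h3 (mul_le_mul_of_nonneg_right h2 hlog2.le)
  have hk1 : 1 ≤ k := by omega
  have hlogQ : HK < logQForall (P k) :=
    lt_of_lt_of_le hkM ((le_logQAvoid_P ha h7 hk1 Nat.prime_three (by norm_num)).trans
      (logQAvoid_anti (P k) (Finset.empty_subset _)))
  have hUP := P_mem_UP ha habar ha' h7 h7' hk6
  -- the `l`-independent bound `D` of the right-hand side's numerator
  set D : ℝ := 24 * ((dmod (P k) : ℝ) - 1) * ((P k).logDiff + (P k).logCond) with hD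
  obtain ⟨l, hl, hlp⟩ := Nat.exists_infinite_primes
    (max (max 8 (⌈((P k).degree : ℝ) * logQForall (P k) / Real.log 2⌉₊ + 1)) (⌈|D| / (k * Real.log 2)⌉₊ + 1))
  have hl8 : 8 ≤ l := ((le_max_left _ _).trans (le_max_left _ _)).trans hl
  have hlpos : (0 : ℝ) < l := by exact_mod_cast (show 0 < l by omega)
  have hP2 : CondP2 (P k) l := by
    apply condP2_of_lt
    have h2 := Nat.le_ceil (((P k).degree : ℝ) * logQForall (P k) / Real.log 2)
    have h3 : ((⌈((P k).degree : ℝ) * logQForall (P k) / Real.log 2⌉₊ + 1 : ℕ) : ℝ) ≤ l := by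
      exact_mod_cast ((le_max_right _ _).trans (le_max_left _ _)).trans hl
    push_cast at h3; linarith
  have hP5 := condP5_P ha h7 hk1 hlp (by omega)
  have hP6 := hHK (P k) (P_mem_std hk6) hUP l hlp (by omega) hP2 hP5 hlogQ
  have hineq := hSz (P k) hUP l hlp (by omega) (admitsCore_P ha h7 hk1) hP2 hP5 hP6 (two_le_dmod_P ha habar ha' h7 h7' hk1)
  -- lower bound of the left side, upper bound of the right side
  have hlow := le_logQAvoid_P ha h7 hk1 hlp (show l ≠ 7 by omega)
  have hc : 0 < (k : ℝ) * Real.log 2 := mul_pos (by exact_mod_cast (show 0 < k by omega)) hlog2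
  have hdm : (0 : ℝ) ≤ 24 * ((dmod (P k) : ℝ) - 1) := by
    have := two_le_dmod_P ha habar ha' h7 h7' hk1
    have : (2 : ℝ) ≤ dmod (P k) := by exact_mod_cast this
    linarith
  have hcond : logCondAvoid (P k) {2, l} ≤ (P k).logCond := logCondAvoid_le_logCond (P k) hUP.1 _
  have hup : 24 * ((dmod (P k) : ℝ) - 1) / l * ((P k).logDiff + logCondAvoid (P k) {2, l}) ≤
      24 * ((dmod (P k) : ℝ) - 1) / l * ((P k).logDiff + (P k).logCond) :=
    mul_le_mul_of_nonneg_left (by linarith) (div_nonneg hdm hlpos.le)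
  have hDeq : 24 * ((dmod (P k) : ℝ) - 1) / l * ((P k).logDiff + (P k).logCond) = D / l := by
    rw [hD]; ring
  rw [hDeq] at hup
  have hDl : D / l < k * Real.log 2 := by
    have h1 : |D| / (k * Real.log 2) ≤ ⌈|D| / (k * Real.log 2)⌉₊ := Nat.le_ceil _
    have h2 : ((⌈|D| / (k * Real.log 2)⌉₊ + 1 : ℕ) : ℝ) ≤ l := by exact_mod_cast (le_max_right _ _).trans hl
    push_cast at h2
    rw [div_le_iff₀ hc] at h1
    have h3 : |D| < l * (k * Real.log 2) := by nlinarith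
    rw [div_lt_iff₀ hlpos]
    calc D ≤ |D| := le_abs_self D
      _ < l * (k * Real.log 2) := h3
      _ = k * Real.log 2 * l := by ring
  linarith

end Summit.ABC.IUTFork.QuadWitness

end
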